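import Literature.Analysis.FluidPDE.LocalEnergySolutionsViscosity
import HarnessLib

/-!
# Local energy solutions on a strip under the Navier–Stokes space–time rescalings

Analysis/FluidPDE proof file (theorems only, no new definitions or facts), companion of
`LocalEnergySolutionsViscosity.lean` (the time dilation `Φ(s, y) = (ν s, y)`). Here Seregin's
strip class with weak continuity in time, `IsLocalEnergySolutionOn T ν V₀ V Q`
(`LocalEnergySolutionsOn.lean`; Seregin 2014, Def. B.1 = Kikuchi–Seregin 2007 = Kang–Miura–Tsai
2021, Def. 3.1), is transported along the full two-parameter family of space–time affine maps
`Φ(s, y) = (β s, x₀ + γ y)` with `β = α γ`, `α, γ > 0`, of `SpaceTimeRescaling.lean`: the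
rescaled fields `α V ∘ Φ`, `α² Q ∘ Φ` form a local energy solution on the strip
`ℝ³ × (0, T/β)` with viscosity `α ν/γ` and datum `y ↦ α V₀(x₀ + γ y)`. The parabolic case
`α = γ = λ`, `β = λ²` is the Navier–Stokes scaling `u_λ(y, s) = λ u(λ y, λ² s)` (with a spatial
recentring), under which local energy solutions are used throughout the local-regularity
literature (Jia–Šverák 2014, §3; Kang–Miura–Tsai 2021, proof of Cor. 1.2: "by scaling";
Barker–Prange 2020, §4.2); the case `α = λ/ν`, `β = λ²/ν`, `γ = λ` also normalises the viscosity.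

* `space_affine_preimage_ball_add_smul` — `A⁻¹(B(x₀ + γ x̄, γ R)) = B(x̄, R)` for
  `A y = x₀ + γ y`;
* `stAffine_zero_preimage_Ioo_prod` — `Φ⁻¹((a, b) × B) = (a/β, b/β) × A⁻¹(B)`;
* `stPreimage_zero_slab_Ioo` — `Φ⁻¹((0, T) × ℝ³) = (0, T/β) × ℝ³`;
* `IsLocalEnergySolutionOn.stRescale` — every clause of Def. B.1 is transported: suitability
  (`IsSuitableWeakSolutionOn.stRescale`), the pressure class, the gradient bound and the decay by
  the change of variables on boxes (a `γ`-ball is covered by finitely many unit balls, uniformly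
  in the centre), the every-time unit-ball bounds, slice measurability, weak continuity on the
  closed interval (test fields pull back to test fields) and the attainment of the datum slice
  by slice.

## References

* G. Seregin, *Lecture Notes on Regularity Theory for the Navier–Stokes Equations* (2014),
  App. B, Def. B.1. [Seregin2014]
* K. Kang, H. Miura, T.-P. Tsai, IMRN 2021 = arXiv:1812.10509, Def. 3.1 and the proof of
  Cor. 1.2 (scaling). [KangMiuraTsai2020]
* L. Caffarelli, R. Kohn, L. Nirenberg, Comm. Pure Appl. Math. 35 (1982), §2 (scaling of the
  equations and of the local energy inequality). [CaffarelliKohnNirenberg1982]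
-/

noncomputable section

open MeasureTheory TopologicalSpace Set Function Filter Metric
open _root_.Topology
open scoped ENNReal NNReal RealInnerProductSpace

namespace Literature.Analysis.FluidPDE

/-! ### Preimages under `Φ(s, y) = (β s, x₀ + γ y)` -/

/-- `A⁻¹(B(x₀ + γ x̄, γ R)) = B(x̄, R)` for the space affine map `A y = x₀ + γ y`, `γ > 0`. [folklore] -/
theorem space_affine_preimage_ball_add_smul {γ : ℝ} (hγ : 0 < γ) (x₀ x₁ : (EuclideanSpace ℝ (Fin 3))) (R : ℝ) :
    (fun y : (EuclideanSpace ℝ (Fin 3)) => x₀ + γ • y) ⁻¹' ball (x₀ + γ • x₁) (γ * R) = ball x₁ R := by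
  ext y
  simp only [mem_preimage, mem_ball, dist_eq_norm]
  have e1 : x₀ + γ • y - (x₀ + γ • x₁) = γ • (y - x₁) := by
    rw [smul_sub]; abel
  rw [e1, norm_smul, Real.norm_eq_abs, abs_of_pos hγ]
  exact ⟨fun h => lt_of_mul_lt_mul_left h hγ.le, fun h => mul_lt_mul_of_pos_left h hγ⟩

/-- `Φ⁻¹((a, b) × B) = (a/β, b/β) × A⁻¹(B)` for `Φ(s, y) = (β s, x₀ + γ y)`, `β > 0`,
`A y = x₀ + γ y`. [folklore] -/
theorem stAffine_zero_preimage_Ioo_prod {β : ℝ} (hβ : 0 < β) (γ : ℝ) (x₀ : (EuclideanSpace ℝ (Fin 3))) (a b : ℝ)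
    (B : Set (EuclideanSpace ℝ (Fin 3))) :
    stAffine β γ 0 x₀ ⁻¹' (Ioo a b ×ˢ B) =
      Ioo (a / β) (b / β) ×ˢ ((fun y : (EuclideanSpace ℝ (Fin 3)) => x₀ + γ • y) ⁻¹' B) := by
  ext ⟨s, y⟩
  simp only [mem_preimage, stAffine_apply, zero_add, mem_prod, mem_Ioo]
  constructor
  · rintro ⟨⟨h1, h2⟩, h3⟩
    exact ⟨⟨(div_lt_iff₀ hβ).2 (by linarith), (lt_div_iff₀ hβ).2 (by linarith)⟩, h3⟩
  · rintro ⟨⟨h1, h2⟩, h3⟩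
    have h1' := (div_lt_iff₀ hβ).1 h1
    have h2' := (lt_div_iff₀ hβ).1 h2
    exact ⟨⟨by linarith, by linarith⟩, h3⟩

/-- `Φ⁻¹((0, T) × ℝ³) = (0, T/β) × ℝ³` for `Φ(s, y) = (β s, x₀ + γ y)`, `β > 0`. [folklore] -/
theorem stPreimage_zero_slab_Ioo {β : ℝ} (hβ : 0 < β) (γ : ℝ) (x₀ : (EuclideanSpace ℝ (Fin 3))) (T : ℝ) :
    stPreimage β γ 0 x₀ (slab (EuclideanSpace ℝ (Fin 3)) (Ioo 0 T) isOpen_Ioo) = slab (EuclideanSpace ℝ (Fin 3)) (Ioo 0 (T / β)) isOpen_Ioo := by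
  ext z
  simp only [coe_stPreimage, mem_preimage, SetLike.mem_coe, mem_slab, stAffine_fst, zero_add,
    mem_Ioo]
  rw [lt_div_iff₀ hβ]
  constructor
  · rintro ⟨h1, h2⟩
    exact ⟨(mul_pos_iff_of_pos_left hβ).1 h1, by linarith⟩
  · rintro ⟨h1, h2⟩
    exact ⟨mul_pos hβ h1, by linarith⟩

/-! ### Local energy solutions under the rescalings -/

/-- **Covariance of Seregin's local energy solutions under the space–time rescalings**
(Seregin 2014, Def. B.1; Caffarelli–Kohn–Nirenberg 1982, §2; Kang–Miura–Tsai 2021, proof of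
Cor. 1.2). If `(V, Q)` is a local energy solution with viscosity `ν` and datum `V₀` on the strip
`ℝ³ × (0, T)`, then for `α, γ > 0`, `β = α γ` and any centre `x₀`, the rescaled pair
`v(s, y) = α V(β s, x₀ + γ y)`, `q(s, y) = α² Q(β s, x₀ + γ y)` is a local energy solution with
viscosity `α ν/γ` and datum `y ↦ α V₀(x₀ + γ y)` on `ℝ³ × (0, T/β)`: suitability and the weak
spatial gradient are covariant (`IsSuitableWeakSolutionOn.stRescale`,
`HasWeakSpatialGradientOn.stRescale`), the pressure class, the unit-box gradient bound and the
decay are transported by the change of variables on boxes (`Φ⁻¹((a, b) × B(x₀ + γ x̄, γ R)) =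
(a/β, b/β) × B(x̄, R)`; a `γ`-ball is covered by finitely many unit balls uniformly in its
centre), the every-time unit-ball bounds and slice measurability slice by slice, weak
continuity on `[0, T/β]` by pulling the test field back along `A⁻¹`, and the attainment of the
datum by composing with `s ↦ β s`. [cite: Seregin2014, Def. B.1 (with CaffarelliKohnNirenberg1982 §2, scaling)] -/
theorem IsLocalEnergySolutionOn.stRescale {T ν : ℝ} {V₀ : (EuclideanSpace ℝ (Fin 3)) → (EuclideanSpace ℝ (Fin 3))} {V : ℝ → (EuclideanSpace ℝ (Fin 3)) → (EuclideanSpace ℝ (Fin 3))}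
    {Q : ℝ → (EuclideanSpace ℝ (Fin 3)) → ℝ} (h : IsLocalEnergySolutionOn T ν V₀ V Q) {α β γ : ℝ} (hα : 0 < α)
    (hγ : 0 < γ) (hβ : β = α * γ) (x₀ : (EuclideanSpace ℝ (Fin 3))) :
    IsLocalEnergySolutionOn (T / β) (α * ν / γ) (fun y => α • V₀ (x₀ + γ • y))
      (α • stPull β γ 0 x₀ V) (α ^ 2 • stPull β γ 0 x₀ Q) := by
  have hβ0 : 0 < β := by rw [hβ]; positivity
  have hn : Module.finrank ℝ (EuclideanSpace ℝ (Fin 3)) = 3 := finrank_euclideanSpace_fin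
  -- the space affine map and its inverse
  set e := spaceAffineHomeomorph hγ.ne' x₀ with he
  have hcoe : (e : (EuclideanSpace ℝ (Fin 3)) → (EuclideanSpace ℝ (Fin 3))) = fun y => x₀ + γ • y := rfl
  have hqmp : Measure.QuasiMeasurePreserving (fun y : (EuclideanSpace ℝ (Fin 3)) => x₀ + γ • y) volume volume := by
    refine ⟨by fun_prop, ?_⟩
    rw [map_space_affine_volume hγ x₀]
    exact Measure.smul_absolutelyContinuous
  have hcpt : ∀ K : Set (EuclideanSpace ℝ (Fin 3)), IsCompact K → IsCompact ((fun y : (EuclideanSpace ℝ (Fin 3)) => x₀ + γ • y) '' K) :=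
    fun K hK => hK.image (by fun_prop)
  have hpreK : ∀ K : Set (EuclideanSpace ℝ (Fin 3)),
      (fun y : (EuclideanSpace ℝ (Fin 3)) => x₀ + γ • y) ⁻¹' ((fun y : (EuclideanSpace ℝ (Fin 3)) => x₀ + γ • y) '' K) = K := fun K => by
    rw [← hcoe]
    exact e.injective.preimage_image K
  -- pointwise form of the rescaled velocity
  have hv : ∀ s y, (α • stPull β γ 0 x₀ V) s y = α • V (β * s) (x₀ + γ • y) := fun s y => by
    rw [smul_stPull_apply, zero_add]
  have hvfun : ∀ s, (α • stPull β γ 0 x₀ V) s = fun y => α • V (β * s) (x₀ + γ • y) := fun s =>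
    funext (hv s)
  -- times in `[0, T/β]` go to times in `[0, T]`
  have hIcc : ∀ {s : ℝ}, s ∈ Icc 0 (T / β) → β * s ∈ Icc 0 T := fun hs =>
    ⟨mul_nonneg hβ0.le hs.1, by
      have h2 := hs.2
      rw [le_div_iff₀ hβ0] at h2
      linarith⟩
  -- boxes: `Φ⁻¹((0, T) × B(x₀ + γ x̄, γ R)) = (0, T/β) × B(x̄, R)`
  have hbox : ∀ (x₁ : (EuclideanSpace ℝ (Fin 3))) (R : ℝ), stAffine β γ 0 x₀ ⁻¹' (Ioo 0 T ×ˢ ball (x₀ + γ • x₁) (γ * R)) =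
      Ioo 0 (T / β) ×ˢ ball x₁ R := fun x₁ R => by
    rw [stAffine_zero_preimage_Ioo_prod hβ0, zero_div, space_affine_preimage_ball_add_smul hγ]
  obtain ⟨G, hG, CG, hCG⟩ := h.uniformLocalGradient
  refine
    { suitable := ?_
      pressure := ?_
      sliceMeasurable := ?_
      uniformLocalEnergy := ?_
      uniformLocalGradient := ?_
      weakContinuous := ?_
      initial := ?_
      decay := ?_ }
  · -- (B.1.5), (B.1.8): suitability is covariant
    have hs := h.suitable.stRescale hα hγ hβ 0 x₀
    rw [stPreimage_zero_slab_Ioo hβ0] at hs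
    have hf : ((α ^ 2 * γ) • stPull β γ 0 x₀ (0 : ℝ → (EuclideanSpace ℝ (Fin 3)) → (EuclideanSpace ℝ (Fin 3)))) = 0 := by
      funext s y
      simp [stPull]
    rw [hf] at hs
    exact hs
  · -- (B.1.4): the pressure class on `(0, T/β) × K`
    intro K hK
    have h1 := setLIntegral_enorm_rpow_stRescale hβ0 hγ 0 x₀ (α ^ 2) Q
      (Ioo 0 T ×ˢ ((fun y : (EuclideanSpace ℝ (Fin 3)) => x₀ + γ • y) '' K)) (r := 3 / 2) (by norm_num)
    rw [stAffine_zero_preimage_Ioo_prod hβ0, zero_div, hpreK] at h1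
    rw [h1]
    exact ENNReal.mul_lt_top (ENNReal.mul_lt_top
      (ENNReal.rpow_lt_top_of_nonneg (by norm_num) enorm_ne_top) ENNReal.ofReal_lt_top)
      (h.pressure _ (hcpt K hK))
  · -- slices are measurable
    intro s hs
    rw [hvfun s]
    exact ((h.sliceMeasurable (β * s) (hIcc hs)).comp_quasiMeasurePreserving hqmp).const_smul α
  · -- (B.1.4): the every-time unit-ball bound (a `γ`-ball of `V` behind each unit ball of `v`)
    obtain ⟨C, hC⟩ := h.exists_forall_lintegral_ball_le γ
    set C₁ : ℝ≥0∞ := ‖α‖ₑ ^ 2 * (ENNReal.ofReal (γ ^ 3)⁻¹ * C) with hC₁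
    have hC₁top : C₁ ≠ ∞ := ENNReal.mul_ne_top (ENNReal.pow_ne_top enorm_ne_top)
      (ENNReal.mul_ne_top ENNReal.ofReal_ne_top ENNReal.coe_ne_top)
    refine ⟨C₁.toNNReal, fun s hs x₁ => ?_⟩
    rw [ENNReal.coe_toNNReal hC₁top]
    have e1 : ∀ y, ‖(α • stPull β γ 0 x₀ V) s y‖ₑ ^ 2 =
        ‖α‖ₑ ^ 2 * (fun x => ‖V (β * s) x‖ₑ ^ 2) (x₀ + γ • y) := fun y => by
      rw [hv, enorm_smul, mul_pow]
    simp_rw [e1]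
    rw [lintegral_const_mul' _ _ (ENNReal.pow_ne_top enorm_ne_top),
      ← space_affine_preimage_ball_add_smul hγ x₀ x₁ 1,
      setLIntegral_preimage_comp_space_affine hγ x₀ (fun x => ‖V (β * s) x‖ₑ ^ 2)
        (ball (x₀ + γ • x₁) (γ * 1)), hn, mul_one]
    exact mul_le_mul' le_rfl (mul_le_mul' le_rfl (hC (β * s) (hIcc hs) (x₀ + γ • x₁)))
  · -- (B.1.4): the weak spatial gradient `α γ ∇V ∘ Φ` and its unit-box bound
    obtain ⟨Fs, hFs⟩ := exists_finset_ball_subset_biUnion_ball_one γ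
    have hγball : ∀ c : (EuclideanSpace ℝ (Fin 3)), ∫⁻ z in Ioo 0 T ×ˢ ball c γ, ENNReal.ofReal (frobeniusNormSq (G z.1 z.2)) ≤
        Fs.card * (CG : ℝ≥0∞) := fun c =>
      calc ∫⁻ z in Ioo 0 T ×ˢ ball c γ, ENNReal.ofReal (frobeniusNormSq (G z.1 z.2))
          ≤ ∫⁻ z in ⋃ d ∈ Fs, Ioo 0 T ×ˢ ball (c + d) 1,
              ENNReal.ofReal (frobeniusNormSq (G z.1 z.2)) := by
            refine lintegral_mono_set fun z hz => ?_
            obtain ⟨d, hd, hzd⟩ := mem_iUnion₂.1 (hFs c hz.2)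
            exact mem_iUnion₂.2 ⟨d, hd, hz.1, hzd⟩
        _ ≤ Fs.card * (CG : ℝ≥0∞) :=
            lintegral_biUnion_finset_le_card_mul Fs _ _ fun d _ => hCG (c + d)
    refine ⟨(α * γ) • stPull β γ 0 x₀ G, ?_, ?_⟩
    · have h1 := hG.stRescale α hβ0 hγ 0 x₀
      rw [stPreimage_zero_slab_Ioo hβ0] at h1
      exact h1
    · set C₁ : ℝ≥0∞ := ENNReal.ofReal ((α * γ) ^ 2) * ENNReal.ofReal (β * γ ^ 3)⁻¹ *
        (Fs.card * (CG : ℝ≥0∞)) with hC₁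
      have hC₁top : C₁ ≠ ∞ :=
        ENNReal.mul_ne_top (ENNReal.mul_ne_top ENNReal.ofReal_ne_top ENNReal.ofReal_ne_top)
          (ENNReal.mul_ne_top (ENNReal.natCast_ne_top _) ENNReal.coe_ne_top)
      refine ⟨C₁.toNNReal, fun x₁ => ?_⟩
      rw [ENNReal.coe_toNNReal hC₁top]
      have h1 := setLIntegral_frobeniusNormSq_stRescale hβ0 hγ 0 x₀ (α * γ) G
        (Ioo 0 T ×ˢ ball (x₀ + γ • x₁) (γ * 1))
      rw [hbox, hn] at h1
      rw [h1, mul_one]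
      exact mul_le_mul' le_rfl (hγball (x₀ + γ • x₁))
  · -- (B.1.6): weak continuity on the closed interval `[0, T/β]`
    intro φ hφ
    -- the pulled-back test field `ψ = φ ∘ A⁻¹`
    set ψ : (EuclideanSpace ℝ (Fin 3)) → (EuclideanSpace ℝ (Fin 3)) := fun x => φ (γ⁻¹ • (x - x₀)) with hψ_def
    have hψsymm : ψ = φ ∘ e.symm := rfl
    have hψ : FunctionSpaces.IsTestFunctionOn (⊤ : Opens (EuclideanSpace ℝ (Fin 3))) ψ := by
      refine ⟨hφ.contDiff.comp ((contDiff_id.sub contDiff_const).const_smul _), ?_, by simp⟩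
      rw [hψsymm]
      exact hφ.hasCompactSupport.comp_homeomorph e.symm
    have hψA : ∀ y, ψ (x₀ + γ • y) = φ y := fun y => by
      change (φ ∘ e.symm) (e y) = φ y
      rw [Function.comp_apply, e.symm_apply_apply]
    have e1 : (fun s => ∫ y, ⟪(α • stPull β γ 0 x₀ V) s y, φ y⟫) =
        fun s => (γ ^ 3)⁻¹ * (α * ∫ x, ⟪V (β * s) x, ψ x⟫) := by
      funext s
      have h2 : ∀ y, ⟪(α • stPull β γ 0 x₀ V) s y, φ y⟫ =
          (fun x => α * ⟪V (β * s) x, ψ x⟫) (x₀ + γ • y) := fun y => by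
        simp only [hv, real_inner_smul_left, hψA]
      simp_rw [h2]
      rw [integral_comp_space_affine hγ x₀ (fun x => α * ⟪V (β * s) x, ψ x⟫), hn,
        integral_const_mul, smul_eq_mul]
    rw [e1]
    have hmap : MapsTo (fun s : ℝ => β * s) (Icc 0 (T / β)) (Icc 0 T) := fun s hs => hIcc hs
    exact continuousOn_const.mul (continuousOn_const.mul
      ((h.weakContinuous ψ hψ).comp (continuous_const_mul β).continuousOn hmap))
  · -- (B.1.7): the datum `α V₀(x₀ + γ ·)` is attained in `L²_loc`
    intro K hK
    change Tendsto (fun s => ∫⁻ y in K, ‖(α • stPull β γ 0 x₀ V) s y - α • V₀ (x₀ + γ • y)‖ₑ ^ 2)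
      (𝓝[>] 0) (𝓝 0)
    have e1 : ∀ s, ∫⁻ y in K, ‖(α • stPull β γ 0 x₀ V) s y - α • V₀ (x₀ + γ • y)‖ₑ ^ 2 =
        ‖α‖ₑ ^ 2 * (ENNReal.ofReal (γ ^ 3)⁻¹ *
          ∫⁻ x in (fun y : (EuclideanSpace ℝ (Fin 3)) => x₀ + γ • y) '' K, ‖V (β * s) x - V₀ x‖ₑ ^ 2) := by
      intro s
      have e2 : ∀ y, ‖(α • stPull β γ 0 x₀ V) s y - α • V₀ (x₀ + γ • y)‖ₑ ^ 2 =
          ‖α‖ₑ ^ 2 * (fun x => ‖V (β * s) x - V₀ x‖ₑ ^ 2) (x₀ + γ • y) := fun y => by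
        rw [hv, ← smul_sub, enorm_smul, mul_pow]
      simp_rw [e2]
      rw [lintegral_const_mul' _ _ (ENNReal.pow_ne_top enorm_ne_top)]
      congr 1
      conv_lhs => rw [← hpreK K]
      rw [setLIntegral_preimage_comp_space_affine hγ x₀ (fun x => ‖V (β * s) x - V₀ x‖ₑ ^ 2) _,
        hn]
    simp_rw [e1]
    have hmap : Tendsto (fun s : ℝ => β * s) (𝓝[>] (0 : ℝ)) (𝓝[>] (0 : ℝ)) := by
      have h1 : Tendsto (fun s : ℝ => β * s) (𝓝 0) (𝓝 (β * 0)) :=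
        (continuous_const_mul β).tendsto 0
      rw [mul_zero] at h1
      refine tendsto_nhdsWithin_of_tendsto_nhds_of_eventually_within _
        (h1.mono_left nhdsWithin_le_nhds) ?_
      filter_upwards [self_mem_nhdsWithin] with s hs
      exact mul_pos hβ0 hs
    have h2 := (h.initial _ (hcpt K hK)).comp hmap
    have h3 := ENNReal.Tendsto.const_mul h2 (Or.inr ENNReal.ofReal_ne_top :
      (0 : ℝ≥0∞) ≠ 0 ∨ ENNReal.ofReal (γ ^ 3)⁻¹ ≠ ∞)
    rw [mul_zero] at h3
    have h4 := ENNReal.Tendsto.const_mul h3 (Or.inr (ENNReal.pow_ne_top enorm_ne_top) :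
      (0 : ℝ≥0∞) ≠ 0 ∨ ‖α‖ₑ ^ 2 ≠ ∞)
    rw [mul_zero] at h4
    exact h4
  · -- decay at spatial infinity on the strip
    intro R hR
    have hbound : ∀ x₁ : (EuclideanSpace ℝ (Fin 3)),
        ∫⁻ z in Ioo 0 (T / β) ×ˢ ball x₁ R, ‖(α • stPull β γ 0 x₀ V) z.1 z.2‖ₑ ^ 2 =
          ‖α‖ₑ ^ 2 * ENNReal.ofReal (β * γ ^ 3)⁻¹ *
            ∫⁻ z in Ioo 0 T ×ˢ ball (x₀ + γ • x₁) (γ * R), ‖V z.1 z.2‖ₑ ^ 2 := by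
      intro x₁
      have h1 := setLIntegral_enorm_pow_stRescale hβ0 hγ 0 x₀ α V
        (Ioo 0 T ×ˢ ball (x₀ + γ • x₁) (γ * R)) 2
      rw [hbox, hn] at h1
      exact h1
    simp_rw [hbound]
    have hA : Tendsto (fun x₁ : (EuclideanSpace ℝ (Fin 3)) => x₀ + γ • x₁) (cocompact (EuclideanSpace ℝ (Fin 3))) (cocompact (EuclideanSpace ℝ (Fin 3))) := by
      rw [← hcoe]
      exact e.map_cocompact.le
    have h2 := (h.decay (γ * R) (by positivity)).comp hA
    have h3 := ENNReal.Tendsto.const_mul h2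
      (Or.inr (ENNReal.mul_ne_top (ENNReal.pow_ne_top enorm_ne_top) ENNReal.ofReal_ne_top) :
        (0 : ℝ≥0∞) ≠ 0 ∨ ‖α‖ₑ ^ 2 * ENNReal.ofReal (β * γ ^ 3)⁻¹ ≠ ∞)
    rw [mul_zero] at h3
    exact h3

end Literature.Analysis.FluidPDE

end
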